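import Literature.MathematicalPhysics.QuantumFieldTheory.Balaban1983to89.Node00.Record12MinimiserSelection
import Literature.MathematicalPhysics.QuantumFieldTheory.Balaban1983to89.B15DeterminingSetsB
import Literature.MathematicalPhysics.QuantumFieldTheory.Balaban1983to89.Node00.SmallFieldChiOfRecordB

/-!
# DAG node N11 — THE MEASURABLE SELECTION OF THE (2.12) MINIMISERS AND THE SCALE-LOCALITY OF THE (2.12) PREDICATE OVER A BOND-LEVEL DETERMINING DATUM
# `𝔅 : BDetSet` (print-datum twins of `…N11BackgroundCoPMeasurable` §1 and `…N11BackgroundScaleLocal` §1; FLAG №16 ∕ LOCATE-HSEAM 5d3298b8d191f169)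

HEADER — WORK-UNIT METADATA.  Cell `pub-ymgap`, YM-PLAN Track A (HUMAN RULING D-0062), seat `pub-ymgap-dag-n11-d` (g41; the N11 [B14] prover pen), (E1) variant (iii-b) work plan
WORKPLAN-IIIB 27c850bec22d4efe (director-ym №338 GO on the additive stages, №341 Stage 2 AUTHORISED-DAYLIGHT), row «S2-TRAIN-N11» (node00-def-R S2-DESIGN-1 (6)(i): the twelve
Summits-side `…N11*` modules in the Stage-2 blast radius are prover-only paths), tranche T1-a; filing key `--kind proof --supports stmt-QuantumFields-20541 --as helper` per
the claim-board rule (count-neutral).  [III] = [Balaban1988Convergent]; [15] = [Balaban1985Variational]; [B6II] = [Balaban1984PropagatorsII].  Over node00-def-RR-2's F0a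
`B15DeterminingSetsB` ✓p765193 (`BDetSet`, `bondsDet`, `AgreeOnB`, `IsMinimizerB`, `lamBondsSeq`, `lamBondsSeq_of_gt`) and node00-def-K0c's `Node00.Record12MinimiserSelection`
(`sigmaClosedContinuous_iterUpTo`, the compact-Polish plumbing) + `Literature.MeasureTheory.RandomSets.exists_measurable_constrained_argmin` — all CONSUMED BY NAME.

HONESTY GUARD (№338 (5)).  This module is the PRINT-DATUM TWIN of `…N11BackgroundCoPMeasurable` §1 (`exists_measurable_isMinimizer_selector_of_isOpen`,
`…_determined_of_isOpen`) and of `…N11BackgroundScaleLocal` §1 (`not_mem_bondsOf_genSet_of_lt`, `agreeOn_genSet_iff_of_agree_le`, `isMinimizer_genSet_iff_of_agree_le`)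
(FLAG №16 ∕ LOCATE-HSEAM 5d3298b8d191f169): every statement below is over an ARBITRARY bond-level datum `𝔅 : BDetSet` supported on finitely many scales; the (b)-instances
(`bondsDet 𝔹`, `bondsDet (genSet Ω k)`) are recovered definitionally (`isMinimizer_iff_isMinimizerB`, `agreeOn_iff_agreeOnB` are `Iff.rfl`) and print's datum is the instance
`lamBondsSeq Ω k` ([B6II] (2.3), ruling (α) of №339).  The (b)-modules STAY LANDED AND TRUE on their own text; NOTHING in them is edited here; no displayed premise of any
consumer is deleted or weakened.

WHY THIS FILE.  After Stage 2 re-points the record's multi-scale background `UbgOfRecord₁₃CoP … (n+1)` to the minimiser over PRINT's datum (`UminOfRecordB … (lamBondsSeq s.Ω k)`,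
node00-def-R S2a∕S2b), the record-level rows `measurable_UbgOfRecord₁₃CoP` (`…N11BackgroundCoPMeasurable` §3) and `UbgOfRecord₁₃CoP_congr_of_agree_le` (`…N11BackgroundScaleLocal`
§2) must be re-proved through bond-level twins of their generic lemmas.  The two ingredients that depend on NO Stage-2 name are typed here, against F0a alone: (§1) K0c's
measurable selection of the (2.12) minimisers PORTS to bond-level constraints — the closed relation of the selection theorem is already indexed by (level, bond), so the port is
`bondsOf (𝔹 j)` ↦ `𝔅 j` —, which also answers def-R's S2c rider «if K0c's selector ports to `AgreeOnB` constraints» in the kernel; (§2) the (2.12) predicate over a datum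
supported on scales `≤ k` reads the data `𝐖` at scales `≤ k` only.  The Stage-2-keyed corollaries (`measurable_UminOfRecordB_of_isOpen`, `measurable_UbgMSCoPOfRecord(At)B`,
`UbgMSCoPOfRecord(At)B_congr_of_agree_le`) are appended to THIS file when S2a∕S2b land (append-only editions).  v1.1 (this edition, over node00-def-R's S2a
`Node00/SmallFieldChiOfRecordB`): §3 `measurable_UminOfRecordB_of_isOpen` ∕ `…_lamBondsSeq_of_isOpen` · §4 `UminOfRecordB_congr_of_agree_le` ∕ `…_lamBondsSeq_…` · §5 print's datum along a
no-expansion step `genSet_succ_eq_of_Omega_empty_of_agree` ∕ ★ `lamBondsSeq_succ_eq_of_Omega_empty_of_agree`; the `UbgMSCoPOfRecord(At)B`-level faces live next to their (b)-originals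
(`…N11BackgroundCoPMeasurable` §3, `…N11BackgroundScaleLocal` §2, `…N11NoExpansionAtRecord13CoP` §Backgrounds; editions of the train).

WHAT THIS FILE PROVES (0 `sorry`, 0 `def`).  §1 `agreeOnB_avgFamily_iff_fin`, `agreeOnB_of_isMinimizerB_iff_of_exists`, ★ `exists_measurable_isMinimizerB_selector_of_isOpen`,
★ `exists_measurable_isMinimizerB_selector_determined_of_isOpen`.  §2 `agreeOnB_iff_of_agree_le`, `isMinimizerB_iff_of_agree_le` (any `𝔅` empty above scale `k`),
`agreeOnB_lamBondsSeq_iff_of_agree_le`, `isMinimizerB_lamBondsSeq_iff_of_agree_le` (print's datum).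

HONEST FRAMING.  Kernel theorems about the tree's own objects (compactness of `SU(N)^{bonds}`, a selection theorem, continuity, bookkeeping of a predicate); existence ∕
uniqueness of the (2.12) minimiser ([15] Thm 1) is NOT used and NOT asserted; nothing of Bałaban's analysis is asserted.  Stage 2 is NOT filed by this module; K0⁷ stub 1
NOT closed; N11 NOT discharged; counts unmoved (typed 28∕28 · discharged 8∕27).  One finite four-torus programme at fixed `ε = L^{−K}` — NOT ℝ⁴, NOT OS, NOT a mass gap,
NOT Clay.  No `sorry`, `axiom`, `instance` (local `haveI` only, as in K0c), `notation`.
Sources (SHAPE only): [III] (2.2) p.255, (2.10)–(2.13) pp.256–257; [15] (2), (5)–(6) p.278; [B6II] (2.3) p.224.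
-/

noncomputable section

open Set
open _root_.MeasureTheory _root_.TopologicalSpace

namespace Summit.QuantumFields.YangMills.Theorems.BalabanUVNodesN11BackgroundCoPMeasurableB

open Literature.MathematicalPhysics.QuantumFieldTheory.Balaban1983to89 T4Continuum Node00 B15DeterminingSets B15DeterminingSetsB B14.Eq213DetSet B14.Eq216Concrete
open Literature.MeasureTheory.RandomSets
open Literature.MathematicalPhysics.QuantumLattice (fundamentalRep continuous_fundamentalRep fundamentalRep_injective)

/-! ## §1  ★ K0c's measurable selection of the (2.12) minimisers over a BOND-LEVEL datum and an arbitrary OPEN regularity class -/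

section Selector

variable {P : Params} {G : Type*} [GaugeGroup G]

/-- The (2.10) constraint on a bond-level datum supported on scales `≤ J` reads on the levels `j ≤ J` only (twin of K0c's `agreeOn_avgFamily_iff_fin`).
[cite: Balaban1988Convergent, (2.10)–(2.11) p.256 (bookkeeping)] -/
theorem agreeOnB_avgFamily_iff_fin (av : ∀ j, Averaging P j G) {𝔅 : BDetSet P} {J : ℕ} (h𝔅 : ∀ j, J < j → 𝔅 j = ∅) (U : GaugeField P 0 G) (W : MSField P G) :
    AgreeOnB 𝔅 (avgFamily av U) W ↔ ∀ j : Fin (J + 1), ∀ b ∈ 𝔅 j, Averaging.iter av j U b = W j b := by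
  constructor
  · intro h j b hb
    exact h j b hb
  · intro h j b hb
    by_cases hj : j ≤ J
    · exact h ⟨j, Nat.lt_succ_of_le hj⟩ b hb
    · rw [h𝔅 j (lt_of_not_ge hj)] at hb
      exact absurd hb (Set.notMem_empty b)

/-- Two SOLVABLE data with the same (2.12) minimal configurations over `𝔅` AGREE ON `𝔅` (twin of K0c's `agreeOn_of_isMinimizer_iff_of_exists`).
[cite: Balaban1988Convergent, (2.10)–(2.12) p.256 (bookkeeping)] -/
theorem agreeOnB_of_isMinimizerB_iff_of_exists {av : ∀ j, Averaging P j G} {reg : Set (GaugeField P 0 G)} {𝔅 : BDetSet P} {W W' : MSField P G}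
    (h : ∀ U₀, IsMinimizerB av reg 𝔅 W U₀ ↔ IsMinimizerB av reg 𝔅 W' U₀) (hW : ∃ U₀, IsMinimizerB av reg 𝔅 W U₀) :
    AgreeOnB 𝔅 W W' := by
  obtain ⟨U₀, hU₀⟩ := hW
  intro j b hb
  rw [← hU₀.2.1 j b hb, ← ((h U₀).mp hU₀).2.1 j b hb]

variable (F : T4Family) (N : ℕ) [NeZero N]

/-- `Re tr` is continuous on `SU(N)` (private copy, as in K0c). [folklore] -/
private theorem continuous_reTr_SU' : Continuous (reTr : SU N → ℝ) :=
  UnitaryModel.continuous_nReTr.comp (continuous_fundamentalRep (Fin N))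

/-- Plaquette variables are continuous in the configuration (private copy, as in K0c). [folklore] -/
private theorem continuous_plaqHol' {P : Params} {j : ℕ} (p : Plaq P j) : Continuous fun U : GaugeField P j (SU N) => GaugeField.plaqHol U p := by
  have hb : ∀ b : PBond P j, Continuous fun U : GaugeField P j (SU N) => U b := fun b => continuous_apply b
  unfold GaugeField.plaqHol
  exact (((hb _).mul (hb _)).mul (hb _).inv).mul (hb _).inv

/-- The Wilson action is a continuous function of the configuration (private copy, as in K0c). [folklore] -/
private theorem continuous_wilsonAction4' {P : Params} {j : ℕ} : Continuous (wilsonAction4 : GaugeField P j (SU N) → ℝ) := by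
  unfold wilsonAction4 wilsonAction
  exact continuous_finsetSum _ fun p _ =>
    continuous_const.mul (continuous_const.sub ((continuous_reTr_SU' N).comp (continuous_plaqHol' N p)))

/-- **★ A MEASURABLE SELECTOR OF THE (2.12) MINIMISERS over a BOND-LEVEL datum `𝔅` supported on scales `≤ J` and an arbitrary OPEN regularity class `reg`**: the
print-datum twin of `…N11BackgroundCoPMeasurable.exists_measurable_isMinimizer_selector_of_isOpen` (FLAG №16 ∕ LOCATE-HSEAM 5d3298b8d191f169); the (b)-instance is the case
`𝔅 := bondsDet 𝔹` (`isMinimizer_iff_isMinimizerB`), which stays landed and true on its own text.  K0c's proof VERBATIM with `bondsOf (𝔹 j)` ↦ `𝔅 j`: the closed constraint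
relation of the selection theorem is indexed by (level, bond) already. [cite: Balaban1988Convergent, (2.12) p.256] -/
theorem exists_measurable_isMinimizerB_selector_of_isOpen (K : ℕ) {reg : Set (GaugeField (F.P K) 0 (SU N))} (hreg : IsOpen reg) (𝔅 : BDetSet (F.P K)) (J : ℕ)
    (h𝔅 : ∀ j, J < j → 𝔅 j = ∅) :
    ∃ f : MSField (F.P K) (SU N) → GaugeField (F.P K) 0 (SU N), Measurable f ∧
      (∀ W, (∃ U₀, IsMinimizerB (avOfRecord F N K) reg 𝔅 W U₀) → IsMinimizerB (avOfRecord F N K) reg 𝔅 W (f W)) ∧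
      (∀ W, ¬ (∃ U₀, IsMinimizerB (avOfRecord F N K) reg 𝔅 W U₀) → f W = 1) := by
  -- the configuration spaces `SU(N)^{bonds}` are compact Polish with Borel = product σ-algebra (verbatim from K0c)
  have hemb : Topology.IsClosedEmbedding (fundamentalRep (Fin N)) :=
    (continuous_fundamentalRep (Fin N)).isClosedEmbedding (fundamentalRep_injective (Fin N))
  haveI : SecondCountableTopology (SU N) := by
    haveI := secondCountableTopology_matrix (n := Fin N)
    exact hemb.isEmbedding.secondCountableTopology
  haveI : PolishSpace (SU N) := by
    haveI : PolishSpace (Matrix (Fin N) (Fin N) ℂ) := inferInstanceAs (PolishSpace (Fin N → Fin N → ℂ))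
    exact hemb.polishSpace
  haveI : ∀ j, CompactSpace (GaugeField (F.P K) j (SU N)) := fun j => inferInstanceAs (CompactSpace (PBond (F.P K) j → SU N))
  haveI : PolishSpace (GaugeField (F.P K) 0 (SU N)) := inferInstanceAs (PolishSpace (PBond (F.P K) 0 → SU N))
  haveI : ∀ j, SecondCountableTopology (GaugeField (F.P K) j (SU N)) := fun j =>
    inferInstanceAs (SecondCountableTopology (PBond (F.P K) j → SU N))
  haveI : ∀ j, BorelSpace (GaugeField (F.P K) j (SU N)) := fun j => inferInstanceAs (BorelSpace (PBond (F.P K) j → SU N))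
  -- the data map `π`, the piecewise-continuous constraint map `g`, the closed relation `R` (indexed by level and BOND)
  let Z : Type := (j : Fin (J + 1)) → GaugeField (F.P K) j (SU N)
  let π : MSField (F.P K) (SU N) → Z := fun W j => W j
  let g : GaugeField (F.P K) 0 (SU N) → Z := fun U j => Averaging.iter (avOfRecord F N K) j U
  let R : Set (Z × Z) := {p | ∀ j : Fin (J + 1), ∀ b ∈ 𝔅 j, p.1 j b = p.2 j b}
  have hπ : Measurable π := measurable_pi_lambda _ fun j => measurable_pi_apply _
  have hg : SigmaClosedContinuous g := sigmaClosedContinuous_iterUpTo F N K J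
  have hcoord : ∀ (j : Fin (J + 1)) (b : PBond (F.P K) j), Continuous fun z : Z => z j b := fun j b =>
    (show Continuous fun V : GaugeField (F.P K) j (SU N) => V b from continuous_apply b).comp (continuous_apply j)
  have hR : IsClosed R := by
    simp only [R, setOf_forall]
    refine isClosed_iInter fun j => isClosed_iInter fun b => isClosed_iInter fun _ => ?_
    exact isClosed_eq ((hcoord j b).comp continuous_fst) ((hcoord j b).comp continuous_snd)
  have hadm : ∀ (U : GaugeField (F.P K) 0 (SU N)) (W : MSField (F.P K) (SU N)),
      (U ∈ reg ∧ (g U, π W) ∈ R) ↔ (U ∈ reg ∧ AgreeOnB 𝔅 (avgFamily (avOfRecord F N K) U) W) :=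
    fun U W => and_congr Iff.rfl (agreeOnB_avgFamily_iff_fin (avOfRecord F N K) h𝔅 U W).symm
  obtain ⟨f, hfm, hfin, hfout⟩ := exists_measurable_constrained_argmin hπ hg hreg hR
    (continuous_wilsonAction4' N (P := F.P K) (j := 0)) (1 : GaugeField (F.P K) 0 (SU N))
  refine ⟨f, hfm, fun W hW => ?_, fun W hW => ?_⟩
  · obtain ⟨U₀, hU₀reg, hagree, hmin⟩ := hW
    have hex : ∃ y, (y ∈ reg ∧ (g y, π W) ∈ R) ∧ ∀ z, z ∈ reg ∧ (g z, π W) ∈ R → wilsonAction4 y ≤ wilsonAction4 z :=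
      ⟨U₀, (hadm U₀ W).mpr ⟨hU₀reg, hagree⟩, fun z hz => hmin z ((hadm z W).mp hz).1 ((hadm z W).mp hz).2⟩
    obtain ⟨hf₁, hf₂⟩ := hfin W hex
    obtain ⟨hfreg, hfagree⟩ := (hadm (f W) W).mp hf₁
    exact ⟨hfreg, hfagree, fun U hU hUa => hf₂ U ((hadm U W).mpr ⟨hU, hUa⟩)⟩
  · refine hfout W fun h => hW ?_
    obtain ⟨y, hy, hmin⟩ := h
    obtain ⟨hyreg, hyagree⟩ := (hadm y W).mp hy
    exact ⟨y, hyreg, hyagree, fun U hU hUa => hmin U ((hadm U W).mpr ⟨hU, hUa⟩)⟩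

/-- **★ THE DETERMINED SELECTOR over a bond-level datum and an arbitrary open class**: the selector precomposed with the projection of the data onto the bonds of `𝔅` (unit
elsewhere) — measurable, minimising, unit off the solvable set, and a FUNCTION OF THE MINIMAL ORBIT.  Print-datum twin of
`…N11BackgroundCoPMeasurable.exists_measurable_isMinimizer_selector_determined_of_isOpen` (FLAG №16 ∕ LOCATE-HSEAM 5d3298b8d191f169); the (b)-instance `𝔅 := bondsDet 𝔹` stays
landed and true on its own text. [cite: Balaban1988Convergent, (2.10)–(2.12) p.256] -/
theorem exists_measurable_isMinimizerB_selector_determined_of_isOpen (K : ℕ) {reg : Set (GaugeField (F.P K) 0 (SU N))} (hreg : IsOpen reg)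
    (𝔅 : BDetSet (F.P K)) (J : ℕ) (h𝔅 : ∀ j, J < j → 𝔅 j = ∅) :
    ∃ f : MSField (F.P K) (SU N) → GaugeField (F.P K) 0 (SU N), Measurable f ∧
      (∀ W, (∃ U₀, IsMinimizerB (avOfRecord F N K) reg 𝔅 W U₀) → IsMinimizerB (avOfRecord F N K) reg 𝔅 W (f W)) ∧
      (∀ W, ¬ (∃ U₀, IsMinimizerB (avOfRecord F N K) reg 𝔅 W U₀) → f W = 1) ∧
      (∀ W W', (∀ U₀, IsMinimizerB (avOfRecord F N K) reg 𝔅 W U₀ ↔ IsMinimizerB (avOfRecord F N K) reg 𝔅 W' U₀) → f W = f W') := by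
  classical
  obtain ⟨f₀, hf₀m, hf₀in, hf₀out⟩ := exists_measurable_isMinimizerB_selector_of_isOpen F N K hreg 𝔅 J h𝔅
  -- the projection of the data onto the bonds of `𝔅` (unit elsewhere)
  let π : MSField (F.P K) (SU N) → MSField (F.P K) (SU N) := fun W j b => if b ∈ 𝔅 j then W j b else 1
  have hπm : Measurable π := by
    refine measurable_pi_lambda _ fun j => measurable_pi_lambda _ fun b => ?_
    by_cases hb : b ∈ 𝔅 j
    · simp only [π, if_pos hb]
      exact (measurable_pi_apply b).comp (measurable_pi_apply j)
    · simp only [π, if_neg hb]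
      exact measurable_const
  have hagree : ∀ (V W : MSField (F.P K) (SU N)), AgreeOnB 𝔅 V (π W) ↔ AgreeOnB 𝔅 V W := fun V W => by
    refine forall_congr' fun j => forall_congr' fun b => forall_congr' fun hb => ?_
    simp only [π, if_pos hb]
  have hmin : ∀ (W : MSField (F.P K) (SU N)) (U₀ : GaugeField (F.P K) 0 (SU N)),
      IsMinimizerB (avOfRecord F N K) reg 𝔅 (π W) U₀ ↔ IsMinimizerB (avOfRecord F N K) reg 𝔅 W U₀ := fun W U₀ => by
    simp only [IsMinimizerB, hagree]
  have hπeq : ∀ W W' : MSField (F.P K) (SU N),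
      (∀ U₀, IsMinimizerB (avOfRecord F N K) reg 𝔅 W U₀ ↔ IsMinimizerB (avOfRecord F N K) reg 𝔅 W' U₀) →
      (∃ U₀, IsMinimizerB (avOfRecord F N K) reg 𝔅 W U₀) → π W = π W' := fun W W' h hW => by
    have hWW' : AgreeOnB 𝔅 W W' := agreeOnB_of_isMinimizerB_iff_of_exists h hW
    funext j b
    by_cases hb : b ∈ 𝔅 j
    · simp only [π, if_pos hb]
      exact hWW' j b hb
    · simp only [π, if_neg hb]
  refine ⟨f₀ ∘ π, hf₀m.comp hπm, fun W hW => ?_, fun W hW => ?_, fun W W' h => ?_⟩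
  · exact (hmin W _).mp (hf₀in (π W) (by obtain ⟨U₀, hU₀⟩ := hW; exact ⟨U₀, (hmin W U₀).mpr hU₀⟩))
  · exact hf₀out (π W) fun ⟨U₀, hU₀⟩ => hW ⟨U₀, (hmin W U₀).mp hU₀⟩
  · by_cases hW : ∃ U₀, IsMinimizerB (avOfRecord F N K) reg 𝔅 W U₀
    · show f₀ (π W) = f₀ (π W')
      rw [hπeq W W' h hW]
    · have hW' : ¬ ∃ U₀, IsMinimizerB (avOfRecord F N K) reg 𝔅 W' U₀ := fun ⟨U₀, hU₀⟩ => hW ⟨U₀, (h U₀).mpr hU₀⟩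
      show f₀ (π W) = f₀ (π W')
      rw [hf₀out (π W) fun ⟨U₀, hU₀⟩ => hW ⟨U₀, (hmin W U₀).mp hU₀⟩,
        hf₀out (π W') fun ⟨U₀, hU₀⟩ => hW' ⟨U₀, (hmin W' U₀).mp hU₀⟩]

end Selector

/-! ## §2  The (2.12) predicate over a datum supported on scales `≤ k` reads the data at scales `≤ k` only (print's datum `lamBondsSeq Ω k` included) -/

section ScaleLocal

variable {P : Params} {G : Type*} [GaugeGroup G]

omit [GaugeGroup G] in
/-- Agreement (2.10) on a bond-level datum empty above scale `k` reads `𝐖` at scales `≤ k` only. [cite: Balaban1988Convergent, (2.2) p.255, (2.10) p.256] -/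
theorem agreeOnB_iff_of_agree_le {𝔅 : BDetSet P} {k : ℕ} (h𝔅 : ∀ j, k < j → 𝔅 j = ∅) {W W' : MSField P G} (h : ∀ i, i ≤ k → W i = W' i) (f : MSField P G) :
    AgreeOnB 𝔅 f W ↔ AgreeOnB 𝔅 f W' := by
  refine forall_congr' fun i => forall_congr' fun b => forall_congr' fun hb => ?_
  by_cases hi : i ≤ k
  · rw [h i hi]
  · rw [h𝔅 i (lt_of_not_ge hi)] at hb
    exact absurd hb (Set.notMem_empty b)

/-- **(BL) for the (2.12) predicate over a bond-level datum empty above scale `k`**: `IsMinimizerB av reg 𝔅 𝐖 U₀` depends on `𝐖` only through `𝐖 i, i ≤ k` (twin of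
`…N11BackgroundScaleLocal.isMinimizer_genSet_iff_of_agree_le`; FLAG №16 ∕ LOCATE-HSEAM 5d3298b8d191f169 — the (b)-instance stays landed and true on its own text).
[cite: Balaban1988Convergent, (2.12) p.256; Balaban1985Variational, (2), (5)–(6) p.278] -/
theorem isMinimizerB_iff_of_agree_le (av : ∀ j, Averaging P j G) (reg : Set (GaugeField P 0 G)) {𝔅 : BDetSet P} {k : ℕ} (h𝔅 : ∀ j, k < j → 𝔅 j = ∅)
    {W W' : MSField P G} (h : ∀ i, i ≤ k → W i = W' i) (U₀ : GaugeField P 0 G) :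
    IsMinimizerB av reg 𝔅 W U₀ ↔ IsMinimizerB av reg 𝔅 W' U₀ := by
  unfold IsMinimizerB
  simp only [agreeOnB_iff_of_agree_le h𝔅 h]

/-- Print's datum `lamBondsSeq Ω k` ([B6II] (2.3)) has no bond above scale `k` (F0a's `lamBondsSeq_of_gt`). [cite: Balaban1984PropagatorsII, (2.3) p.224 (bookkeeping)] -/
theorem not_mem_lamBondsSeq_of_lt (Ω : ℕ → Set (Site P 0)) {k i : ℕ} (h : k < i) (b : PBond P i) : b ∉ lamBondsSeq Ω k i := by
  rw [lamBondsSeq_of_gt Ω k h]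
  exact Set.notMem_empty b

omit [GaugeGroup G] in
/-- Agreement (2.10) on print's datum `lamBondsSeq Ω k` reads `𝐖` at scales `≤ k` only. [cite: Balaban1988Convergent, (2.2) p.255, (2.10) p.256; Balaban1984PropagatorsII, (2.3) p.224] -/
theorem agreeOnB_lamBondsSeq_iff_of_agree_le (Ω : ℕ → Set (Site P 0)) (k : ℕ) {W W' : MSField P G} (h : ∀ i, i ≤ k → W i = W' i) (f : MSField P G) :
    AgreeOnB (lamBondsSeq Ω k) f W ↔ AgreeOnB (lamBondsSeq Ω k) f W' :=
  agreeOnB_iff_of_agree_le (fun _ hj => lamBondsSeq_of_gt Ω k hj) h f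

/-- **(BL) for the (2.12) predicate over PRINT's datum**: `IsMinimizerB av reg (lamBondsSeq Ω k) 𝐖 U₀` depends on `𝐖` only through `𝐖 i, i ≤ k` — the twin of
`…N11BackgroundScaleLocal.isMinimizer_genSet_iff_of_agree_le` at print's datum (FLAG №16 ∕ LOCATE-HSEAM 5d3298b8d191f169; the (b)-instance stays landed and true on its own text).
[cite: Balaban1988Convergent, (2.12) p.256; Balaban1985Variational, (2), (5)–(6) p.278; Balaban1984PropagatorsII, (2.3) p.224] -/
theorem isMinimizerB_lamBondsSeq_iff_of_agree_le (av : ∀ j, Averaging P j G) (reg : Set (GaugeField P 0 G)) (Ω : ℕ → Set (Site P 0)) (k : ℕ)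
    {W W' : MSField P G} (h : ∀ i, i ≤ k → W i = W' i) (U₀ : GaugeField P 0 G) :
    IsMinimizerB av reg (lamBondsSeq Ω k) W U₀ ↔ IsMinimizerB av reg (lamBondsSeq Ω k) W' U₀ :=
  isMinimizerB_iff_of_agree_le av reg (fun _ hj => lamBondsSeq_of_gt Ω k hj) h U₀

end ScaleLocal

/-! ## §3  (T1-b, over node00-def-R's S2a `Node00/SmallFieldChiOfRecordB`) The (2.12) solution map of record over a bond-level datum IS MEASURABLE over every OPEN class -/

section MeasurableB

variable (F : T4Family) (N : ℕ) [NeZero N]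

/-- **★ def-R's (2.12) SOLUTION MAP OF RECORD OVER A BOND-LEVEL DATUM `UminOfRecordB (avOfRecord F N K) reg 𝔅` IS MEASURABLE over every OPEN regularity class `reg`**
and every datum `𝔅` supported on finitely many scales: §1's determined selector fed to S2a's `measurable_UminOfRecordB_of_selector`.  Print-datum twin of
`…N11BackgroundCoPMeasurable.measurable_UminOfRecord_of_isOpen` (FLAG №16 ∕ LOCATE-HSEAM 5d3298b8d191f169); the (b)-instance stays landed and true on its own text
(`UminOfRecordB_bondsDet`). [cite: Balaban1988Convergent, (2.12)–(2.13) pp.256–257] -/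
theorem measurable_UminOfRecordB_of_isOpen (K : ℕ) {reg : Set (GaugeField (F.P K) 0 (SU N))} (hreg : IsOpen reg) (𝔅 : BDetSet (F.P K)) (J : ℕ)
    (h𝔅 : ∀ j, J < j → 𝔅 j = ∅) : Measurable (UminOfRecordB (avOfRecord F N K) reg 𝔅) := by
  obtain ⟨f, hf, hmin, hjunk, hdet⟩ := exists_measurable_isMinimizerB_selector_determined_of_isOpen F N K hreg 𝔅 J h𝔅
  exact measurable_UminOfRecordB_of_selector _ _ f hf hmin hjunk hdet

/-- **★ … IN PARTICULAR OVER PRINT's DATUM `lamBondsSeq Ω k`** (empty above scale `k`, F0a's `lamBondsSeq_of_gt`).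
[cite: Balaban1988Convergent, (2.12)–(2.13) pp.256–257; Balaban1984PropagatorsII, (2.3) p.224] -/
theorem measurable_UminOfRecordB_lamBondsSeq_of_isOpen (K : ℕ) {reg : Set (GaugeField (F.P K) 0 (SU N))} (hreg : IsOpen reg)
    (Ω : ℕ → Set (Site (F.P K) 0)) (k : ℕ) : Measurable (UminOfRecordB (avOfRecord F N K) reg (lamBondsSeq Ω k)) :=
  measurable_UminOfRecordB_of_isOpen F N K hreg (lamBondsSeq Ω k) k fun _ hj => lamBondsSeq_of_gt Ω k hj

end MeasurableB

/-! ## §4  (T1-b, over S2a) The (2.12) solution map over a datum supported on scales `≤ k` reads the data at scales `≤ k` only -/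

section ScaleLocalB

variable {P : Params} {G : Type*} [GaugeGroup G] [MeasurableSpace G]

/-- **def-R's SOLUTION MAP OVER A BOND-LEVEL DATUM EMPTY ABOVE SCALE `k` READS `𝐖` AT SCALES `≤ k` ONLY** (`UminOfRecordB` is a function of the (2.12) predicate —
S2a's `UminOfRecordB_congr_of_isMinimizerB_iff₀` — and the predicate reads `𝐖` at scales `≤ k`, §2).  Print-datum twin of the `UminOfRecord`-level step inside
`…N11BackgroundScaleLocal.UbgMSCoPOfRecordAt_congr_of_agree_le` (FLAG №16 ∕ LOCATE-HSEAM 5d3298b8d191f169; the (b)-instance stays landed and true on its own text).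
[cite: Balaban1988Convergent, (2.12)–(2.13) pp.256–257; Balaban1985Variational, (2), (5)–(6) p.278] -/
theorem UminOfRecordB_congr_of_agree_le (av : ∀ j, Averaging P j G) (reg : Set (GaugeField P 0 G)) {𝔅 : BDetSet P} {k : ℕ} (h𝔅 : ∀ j, k < j → 𝔅 j = ∅)
    {W W' : MSField P G} (h : ∀ i, i ≤ k → W i = W' i) : UminOfRecordB av reg 𝔅 W = UminOfRecordB av reg 𝔅 W' :=
  UminOfRecordB_congr_of_isMinimizerB_iff₀ av reg fun U₀ => isMinimizerB_iff_of_agree_le av reg h𝔅 h U₀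

/-- **… IN PARTICULAR OVER PRINT's DATUM `lamBondsSeq Ω k`.** [cite: Balaban1988Convergent, (2.12)–(2.13) pp.256–257; Balaban1984PropagatorsII, (2.3) p.224] -/
theorem UminOfRecordB_lamBondsSeq_congr_of_agree_le (av : ∀ j, Averaging P j G) (reg : Set (GaugeField P 0 G)) (Ω : ℕ → Set (Site P 0)) (k : ℕ)
    {W W' : MSField P G} (h : ∀ i, i ≤ k → W i = W' i) :
    UminOfRecordB av reg (lamBondsSeq Ω k) W = UminOfRecordB av reg (lamBondsSeq Ω k) W' :=
  UminOfRecordB_congr_of_agree_le av reg (fun _ hj => lamBondsSeq_of_gt Ω k hj) h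

end ScaleLocalB

/-! ## §5  (F0a only) Print's datum along a no-expansion step: `Λ`-bonds of `{Ω_j}_{j ≤ k+1}` with `Ω_{k+1} = ∅` ARE those of `{Ω_j}_{j ≤ k}` (`k ≥ 1`) -/

section NoExpansionB

variable {P : Params}

/-- **(2.2) ALONG A NO-EXPANSION STEP, generic form**: for `k ≥ 1`, `Ω_{k+1} = ∅` and `Ω′_j = Ω_j` (`j ≤ k`), the (b)-datum of `(Ω, k+1)` IS that of `(Ω′, k)` — node00-def-T's
`genSet_succ_eq_init_of_Omega_empty` with the sequence structure abstracted to the agreement hypothesis. [cite: Balaban1988Convergent, (2.2) p.255] -/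
theorem genSet_succ_eq_of_Omega_empty_of_agree {Ω Ω' : ℕ → Set (Site P 0)} {k : ℕ} (hk : 1 ≤ k) (hagree : ∀ j, j ≤ k → Ω' j = Ω j)
    (hΩ : Ω (k + 1) = ∅) : genSet Ω (k + 1) = genSet Ω' k := by
  funext i
  unfold genSet
  congr 1
  unfold gammaRegion
  rcases Nat.lt_trichotomy i k with hi | rfl | hi
  · by_cases hi0 : i = 0
    · subst hi0
      rw [if_neg (by omega), if_neg (by omega), if_pos rfl, if_neg (by omega), if_neg (by omega), if_pos rfl, hagree 1 hk]
    · rw [if_neg (by omega), if_neg (by omega), if_neg hi0, if_neg (by omega), if_neg (by omega), if_neg hi0,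
        hagree i (le_of_lt hi), hagree (i + 1) (Nat.succ_le_of_lt hi)]
  · rw [if_neg (by omega), if_neg (by omega), if_neg (by omega), if_neg (lt_irrefl _), if_pos rfl, hΩ, Set.sdiff_empty, hagree i le_rfl]
  · by_cases hik : i = k + 1
    · subst hik
      rw [if_neg (lt_irrefl _), if_pos rfl, hΩ, if_pos hi]
    · rw [if_pos (by omega), if_pos hi]

/-- **PRINT's DATUM ALONG A NO-EXPANSION STEP**: for `k ≥ 1`, `Ω_{k+1} = ∅` and `Ω′_j = Ω_j` (`j ≤ k`), `lamBondsSeq Ω (k+1) = lamBondsSeq Ω′ k` — the same bonds meet the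
same `Γ_j^{(j)}`, and the inward-connector exclusion at level `j < k` reads `Ω_{j+1} = Ω′_{j+1}`, while at level `k` it excludes nothing (`Ω_{k+1} = ∅`).  The print-datum twin
of `genSet_succ_eq_init_of_Omega_empty` (FLAG №16 ∕ LOCATE-HSEAM 5d3298b8d191f169). [cite: Balaban1984PropagatorsII, (2.3) p.224; Balaban1988Convergent, (2.2) p.255] -/
theorem lamBondsSeq_succ_eq_of_Omega_empty_of_agree {Ω Ω' : ℕ → Set (Site P 0)} {k : ℕ} (hk : 1 ≤ k) (hagree : ∀ j, j ≤ k → Ω' j = Ω j)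
    (hΩ : Ω (k + 1) = ∅) : lamBondsSeq Ω (k + 1) = lamBondsSeq Ω' k := by
  have hgen := genSet_succ_eq_of_Omega_empty_of_agree hk hagree hΩ
  funext j
  ext b
  rw [mem_lamBondsSeq_iff, mem_lamBondsSeq_iff, hgen]
  refine and_congr Iff.rfl ?_
  rcases Nat.lt_trichotomy j k with hj | rfl | hj
  · rw [hagree (j + 1) (Nat.succ_le_of_lt hj)]
    exact ⟨fun h _ => h (by omega), fun h _ => h hj⟩
  · constructor
    · exact fun _ h => absurd h (lt_irrefl _)
    · intro _ _
      rw [hΩ]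
      exact ⟨fun h => h.elim, fun h => h.elim⟩
  · exact ⟨fun _ h => absurd h (by omega), fun _ h => absurd h (by omega)⟩

end NoExpansionB

end Summit.QuantumFields.YangMills.Theorems.BalabanUVNodesN11BackgroundCoPMeasurableB

end
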